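import Summits.ResolutionOfSingularities.ResolutionOfSingularities.Theorems.RadicialJungCleanModelsDimTwoFFiniteChart
import Summits.ResolutionOfSingularities.ResolutionOfSingularities.Theorems.RadicialJungCleanModelsDimTwoFFiniteHelpers
import Summits.ResolutionOfSingularities.ResolutionOfSingularities.Theorems.RadicialJungCleanModelsStubLooseCleanOfGiraud15
import HarnessLib

/-!
# Giraud's theorem on an affine chart, read as loose cleanness (crux `CleanModels`, line `Sketch` rev 10)

Route `ResolutionOfSingularities/RadicialJung`, crux item `CleanModels`
(stmt-ResolutionOfSingularities-15917), line `Sketch` rev 10 (lead c2), stub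
`stub_principalizationDimTwoFFinite`. Given the named fact `Giraud1983Thm24` (taken here as an
expanded hypothesis `hG`, so that this file does not wait for the Literature file), a regular
integral model `V` of dimension `2`, locally of finite type over an `F`-finite field `k` of
characteristic `p`, a non-empty affine open `D' ⊆ V` and a section `s ∈ Γ(V, D')` whose rational
function `r` is not a `p`-th power, `exists_giraudChart` produces Giraud's modification
`πX : X' → D'` — proper, `X'` integral and regular, an isomorphism off a closed subset `Z ⊆ D'`
of `V` consisting of closed points — on which at EVERY point `x'` some representative
`c₀^p + c₁^p · (πX ≫ D'.ι)^♯ r` (`c₁ ≠ 0`, `c_i ∈ K(X')`) is LOOSELY CLEAN in `𝒪_{X',x'}`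
(Giraud's normal form `stub_looseCleanOfGiraud15`).

* `not_isClosed_singleton_genericPoint` — the generic point of an integral scheme of non-zero
  dimension is not closed;
* `isDominant_of_isIso_morphismRestrict` — a morphism into an integral scheme which is an
  isomorphism over a non-empty open is dominant;
* `exists_giraudChart` — the chart theorem above.
-/

noncomputable section

set_option linter.dupNamespace false -- mandated namespace of this single-conjunct summit

open CategoryTheory AlgebraicGeometry TopologicalSpace IsLocalRing
open Literature.AlgebraicGeometry.Resolution Literature.AlgebraicGeometry.Motives
open scoped TensorProduct

namespace Summit.ResolutionOfSingularities.ResolutionOfSingularities.Theorems.RadicialJung.CleanModels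

universe u

/-! ## Two generalities -/

/-- The generic point of an integral scheme of non-zero dimension is not a closed point (otherwise
the scheme is a single point, of dimension `0`). [folklore] -/
theorem not_isClosed_singleton_genericPoint {X : Scheme.{u}} [IsIntegral X]
    (hdim : topologicalKrullDim X ≠ 0) : ¬ IsClosed ({genericPoint X} : Set X) := by
  intro h
  have huniv : (Set.univ : Set X) = {genericPoint X} := by
    have h1 := (genericPoint_spec X).def
    rw [h.closure_eq] at h1
    exact h1.symm
  haveI : Subsingleton X := ⟨fun a b => by
    have ha : a ∈ ({genericPoint X} : Set X) := huniv ▸ Set.mem_univ a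
    have hb : b ∈ ({genericPoint X} : Set X) := huniv ▸ Set.mem_univ b
    rw [Set.mem_singleton_iff] at ha hb
    rw [ha, hb]⟩
  have h0 : topologicalKrullDim X ≤ 0 := topologicalKrullDim_zero_of_discreteTopology X
  have h0' : 0 ≤ topologicalKrullDim X := by
    rw [topologicalKrullDim]
    haveI : Nonempty (IrreducibleCloseds X) :=
      ⟨⟨closure {genericPoint X}, isIrreducible_singleton.closure, isClosed_closure⟩⟩
    exact Order.krullDim_nonneg
  exact hdim (le_antisymm h0 h0')

/-- A morphism into an irreducible scheme which restricts to an isomorphism over a non-empty open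
is dominant. [folklore] -/
theorem isDominant_of_isIso_morphismRestrict {X Y : Scheme.{u}} [IrreducibleSpace Y] (f : X ⟶ Y)
    (U : Y.Opens) (hU : (U : Set Y).Nonempty) [IsIso (f ∣_ U)] : IsDominant f := by
  refine ⟨?_⟩
  have hsub : (U : Set Y) ⊆ Set.range f.base := by
    intro y hy
    obtain ⟨x, hx⟩ := (f ∣_ U).homeomorph.surjective ⟨y, hy⟩
    refine ⟨x.1, ?_⟩
    have := congrArg Subtype.val hx
    simpa [morphismRestrict_base_coe] using this
  have hd : Dense (U : Set Y) := U.2.dense hU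
  exact hd.mono hsub

/-! ## Giraud's theorem on an affine chart -/

/-- **Giraud's theorem on an affine chart of a model, read as loose cleanness.** See the module
docstring. The hypothesis `hG` is the named fact `Giraud1983Thm24` (Giraud 1983, Thm. 2.4 with
Prop. 1.5 (ii)) with Giraud's pointwise normal form spelled out. -/
theorem exists_giraudChart (p : ℕ) [Fact p.Prime] (k : Type) [Field k] [CharP k p]
    (hk : IsFFinite p 1 k)
    (hG : ∀ (p : ℕ) [Fact p.Prime] (X : Scheme.{0}) [IsIntegral X] [CompactSpace X]
      [CharP Γ(X, ⊤) p],
      Scheme.IsRegular X → topologicalKrullDim X = 2 →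
      (∀ (x : X) [CharP (X.presheaf.stalk x) p],
        (frobenius (X.presheaf.stalk x) p).Finite ∧ (frobenius (X.presheaf.stalk x) p).Flat) →
      ∀ f : Γ(X, ⊤),
        (∀ c : X.functionField, c ^ p ≠ (X.presheaf.germ ⊤ (genericPoint X) trivial) f) →
      ∃ (X' : Scheme.{0}) (π : X' ⟶ X), IsProper π ∧ IsIntegral X' ∧ Scheme.IsRegular X' ∧
        (∃ U : X.Opens, ((U : Set X)ᶜ).Finite ∧ (∀ x ∈ (U : Set X)ᶜ, IsClosed ({x} : Set X)) ∧
          IsIso (π ∣_ U)) ∧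
        ∀ x' : X', ∃ (d r : ℕ) (hrd : r ≤ d) (t : Fin d → X'.presheaf.stalk x')
          (g u : X'.presheaf.stalk x') (a : Fin r → ℕ),
          Ideal.span (Set.range t) = maximalIdeal (X'.presheaf.stalk x') ∧
          ringKrullDim (X'.presheaf.stalk x') = (d : WithBot ℕ∞) ∧ (∀ i, 2 ≤ a i) ∧
          (X'.presheaf.germ ⊤ x' trivial) (π.appTop f) =
            g ^ p + u * ∏ i : Fin r, t (Fin.castLE hrd i) ^ a i ∧
          (((∃ i, ¬ p ∣ a i) ∧ IsUnit u) ∨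
            LinearIndependent (ResidueField (X'.presheaf.stalk x'))
              (fun i => ((1 : ResidueField (X'.presheaf.stalk x')) ⊗ₜ[X'.presheaf.stalk x']
                (KaehlerDifferential.D ℤ (X'.presheaf.stalk x')
                  ((Fin.snoc (fun i : Fin r => t (Fin.castLE hrd i)) u :
                    Fin (r + 1) → X'.presheaf.stalk x') i)) :
                ResidueField (X'.presheaf.stalk x') ⊗[X'.presheaf.stalk x']
                  (Ω[X'.presheaf.stalk x'⁄ℤ])))))
    {V : Scheme.{0}} [IsIntegral V] (q : V ⟶ Spec (.of k)) [LocallyOfFiniteType q]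
    (hV : Scheme.IsRegular V) (hdimV : topologicalKrullDim V = 2)
    (D' : V.Opens) (hD' : IsAffineOpen D') (hne : (D' : Set V).Nonempty) (s : Γ(V, D'))
    (r : V.functionField)
    (hr : r = V.presheaf.germ D' (genericPoint V)
      ((genericPoint_spec V).specializes (Set.mem_univ hne.some) |>.mem_open D'.2 hne.some_mem) s)
    (hrp : ∀ c : V.functionField, c ^ p ≠ r) :
    ∃ (X' : Scheme.{0}) (πX : X' ⟶ (D' : Scheme.{0})) (_ : IsIntegral X') (_ : IsDominant πX)
      (_ : IsDominant (πX ≫ D'.ι)),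
      IsProper πX ∧ Scheme.IsRegular X' ∧
      (∃ (Z : Set V) (hZ : IsClosed Z), Z ⊆ (D' : Set V) ∧ (∀ z ∈ Z, IsClosed ({z} : Set V)) ∧
        IsIso (πX ∣_ (D'.ι ⁻¹ᵁ ⟨Zᶜ, hZ.isOpen_compl⟩))) ∧
      ∀ x' : X', ∃ c₀ c₁ : X'.functionField, c₁ ≠ 0 ∧
        ((∃ (d m : ℕ) (hmd : m ≤ d) (t : Fin d → X'.presheaf.stalk x') (a : Fin m → ℕ)
            (w : X'.presheaf.stalk x'), IsUnit w ∧
            Ideal.span (Set.range t) = maximalIdeal (X'.presheaf.stalk x') ∧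
            ringKrullDim (X'.presheaf.stalk x') = (d : WithBot ℕ∞) ∧ 0 < m ∧ (∀ i, ¬ p ∣ a i) ∧
            c₀ ^ p + c₁ ^ p * RatFn.functionFieldMap (πX ≫ D'.ι) r =
              algebraMap (X'.presheaf.stalk x') X'.functionField
                (w * ∏ i : Fin m, t (Fin.castLE hmd i) ^ (a i))) ∨
          (∃ w : X'.presheaf.stalk x', IsUnit w ∧
            c₀ ^ p + c₁ ^ p * RatFn.functionFieldMap (πX ≫ D'.ι) r =
              algebraMap (X'.presheaf.stalk x') X'.functionField w ∧
            ∀ c : X'.presheaf.stalk x', w - c ^ p ∉ maximalIdeal (X'.presheaf.stalk x')) ∨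
          (∃ s' c : X'.presheaf.stalk x',
            c₀ ^ p + c₁ ^ p * RatFn.functionFieldMap (πX ≫ D'.ι) r =
              algebraMap (X'.presheaf.stalk x') X'.functionField s' ∧
            s' - c ^ p ∈ maximalIdeal (X'.presheaf.stalk x') ∧
            s' - c ^ p ∉ maximalIdeal (X'.presheaf.stalk x') ^ 2)) := by
  have hp : p.Prime := Fact.out
  -- the chart `X = ↑D'` and Giraud's hypotheses on it
  haveI : Nonempty (D' : Scheme.{0}) := ⟨⟨_, hne.some_mem⟩⟩
  haveI hXint : IsIntegral (D' : Scheme.{0}) := isIntegral_chart D' hne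
  haveI : CompactSpace (D' : Scheme.{0}) := compactSpace_chart D' hD'
  haveI : CharP Γ((D' : Scheme.{0}), ⊤) p := charP_sections_chart D' p q hne
  have hXreg : Scheme.IsRegular (D' : Scheme.{0}) := isRegular_chart D' hV
  have hXdim : topologicalKrullDim (D' : Scheme.{0}) = 2 :=
    (topologicalKrullDim_chart D' q hne).trans hdimV
  have hXfrob : ∀ (x : (D' : Scheme.{0})) [CharP ((D' : Scheme.{0}).presheaf.stalk x) p],
      (frobenius ((D' : Scheme.{0}).presheaf.stalk x) p).Finite ∧
        (frobenius ((D' : Scheme.{0}).presheaf.stalk x) p).Flat :=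
    fun x _ => frobenius_chart D' p k hk q hV x
  -- the open immersion `ι : ↑D' → V` is dominant
  haveI hιdom : IsDominant D'.ι := ⟨by
    rw [DenseRange, Scheme.Opens.range_ι]
    exact D'.2.dense hne⟩
  -- the section `s` as a global function `fX` on the chart
  set fX : Γ((D' : Scheme.{0}), ⊤) := (D' : Scheme.{0}).presheaf.map
    (eqToHom (Scheme.Opens.ι_preimage_self D').symm).op (D'.ι.app D' s) with hfX
  -- its rational function is `ι^♯ r`
  have hrat : ∀ x : (D' : Scheme.{0}),
      RatFn.toFunctionField x ((D' : Scheme.{0}).presheaf.germ ⊤ x trivial fX) =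
        RatFn.functionFieldMap D'.ι r := by
    intro x
    have hxD : D'.ι.base x ∈ D' := x.2
    rw [hfX, toFunctionField_germ_transport (Scheme.Opens.ι_preimage_self D') x hxD trivial,
      ← functionFieldMap_toFunctionField_germ D'.ι x hxD s, hr,
      toFunctionField_germ' hxD _ s]
  -- `fX` is not a `p`-th power in `K(X)`
  have hfXp : ∀ c : (D' : Scheme.{0}).functionField,
      c ^ p ≠ ((D' : Scheme.{0}).presheaf.germ ⊤ (genericPoint (D' : Scheme.{0})) trivial) fX := by
    intro c
    rw [← toFunctionField_germ' (X := (D' : Scheme.{0})) (U := ⊤) (x := genericPoint _) trivial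
      trivial fX, hrat]
    exact ne_pow_of_bijective _ (RatFn.functionFieldMap_bijective_of_isOpenImmersion D'.ι) p hrp c
  -- Giraud's theorem
  obtain ⟨X', πX, hπXprop, hX'int, hX'reg, ⟨UX, hUXfin, hUXcl, hUXiso⟩, hNF⟩ :=
    hG p (D' : Scheme.{0}) hXreg hXdim hXfrob fX hfXp
  haveI := hX'int; haveI := hπXprop; haveI := hUXiso
  -- `UX` contains the generic point, so `πX` is dominant
  have hηUX : genericPoint (D' : Scheme.{0}) ∈ (UX : Set (D' : Scheme.{0})) := by
    by_contra h
    exact not_isClosed_singleton_genericPoint (X := (D' : Scheme.{0})) (by rw [hXdim]; decide)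
      (hUXcl _ h)
  haveI hπXdom : IsDominant πX := isDominant_of_isIso_morphismRestrict πX UX ⟨_, hηUX⟩
  -- the exceptional set `Z ⊆ V`
  haveI : JacobsonSpace V := LocallyOfFiniteType.jacobsonSpace q
  set Z : Set V := Subtype.val '' ((UX : Set (D' : Scheme.{0}))ᶜ) with hZdef
  have hZcl : ∀ z ∈ Z, IsClosed ({z} : Set V) := by
    rintro _ ⟨x, hx, rfl⟩
    exact isClosed_singleton_of_isClosed_subtype (X := V) (U := (D' : Set V)) D'.2 x (hUXcl x hx)
  have hZ : IsClosed Z := by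
    rw [← Set.biUnion_of_singleton Z]
    exact (hUXfin.image _).isClosed_biUnion fun z hz => hZcl z hz
  have hZD : Z ⊆ (D' : Set V) := by
    rintro _ ⟨x, -, rfl⟩
    exact x.2
  have hpre : D'.ι ⁻¹ᵁ ⟨Zᶜ, hZ.isOpen_compl⟩ = UX := by
    ext x
    change D'.ι.base x ∈ Zᶜ ↔ x ∈ (UX : Set (D' : Scheme.{0}))
    rw [Scheme.Opens.ι_apply, Set.mem_compl_iff, hZdef, Subtype.val_injective.mem_set_image,
      Set.mem_compl_iff, not_not]
    exact Iff.rfl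
  have hiso : IsIso (πX ∣_ (D'.ι ⁻¹ᵁ ⟨Zᶜ, hZ.isOpen_compl⟩)) := by rw [hpre]; exact hUXiso
  refine ⟨X', πX, hX'int, hπXdom, inferInstance, hπXprop, hX'reg, ⟨Z, hZ, hZD, hZcl, hiso⟩,
    fun x' => ?_⟩
  -- pointwise: Giraud's normal form, read as loose cleanness
  haveI : IsRegularLocalRing (X'.presheaf.stalk x') := hX'reg x'
  haveI : CharP (X'.presheaf.stalk x') p := charP_stalk X' (πX ≫ D'.ι ≫ q) x'
  obtain ⟨d, r', hrd, t, g, u, a, ht, hd, -, hf, hc⟩ := hNF x'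
  obtain ⟨c₀, c₁, hc₁, hLC⟩ := stub_looseCleanOfGiraud15 (K := X'.functionField) p hp hrd t ht
    hd g u a _ hf hc
  -- the rational function of the pulled-back section is `(πX ≫ ι)^♯ r`
  have hkey : algebraMap (X'.presheaf.stalk x') X'.functionField
      ((X'.presheaf.germ ⊤ x' trivial) (πX.appTop fX)) = RatFn.functionFieldMap (πX ≫ D'.ι) r := by
    change RatFn.toFunctionField x' _ = _
    have h1 := functionFieldMap_toFunctionField_germ πX (U := ⊤) x' trivial fX
    rw [RatFn.functionFieldMap_comp, RingHom.comp_apply, ← hrat (πX.base x'), h1]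
    rfl
  rw [hkey] at hLC
  exact ⟨c₀, c₁, hc₁, hLC⟩

end Summit.ResolutionOfSingularities.ResolutionOfSingularities.Theorems.RadicialJung.CleanModels

end
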